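import Summits.BirchSwinnertonDyer.BirchSwinnertonDyer.Theorems.AlignedTransportAtTwoMainConjectureOfRankZeroBSDAtTwoHalfDescentLayerIndexTower
import Summits.BirchSwinnertonDyer.Rank1Residual.X1.GeneratorBoundMu
import Literature.NumberTheory.EllipticCurves.IwasawaAlgebraSpecializationTorsionBoundProofs
import Literature.NumberTheory.EllipticCurves.IwasawaAlgebraRankOneIdealProofs
import Summits.BirchSwinnertonDyer.Rank1Residual.X1.MuPart
import HarnessLib

/-!
# Route `AlignedTransportAtTwo`, crux C2 `MainConjectureOfRankZeroBSDAtTwo` (stmt-BirchSwinnertonDyer-22298):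
# THE DESCENT NUMBER WITHOUT GREENBERG 4.14, I — THE LAYER INDEX WITH A FINITE SUBMODULE: for EVERY finitely generated torsion `Λ`-module `X`
# (finite submodules allowed), `char_Λ X = (f)`, `F` its largest finite submodule and an Eisenstein distinguished `g` with `λ(f) < deg g`:
# `#(X/gX) = p^{deg g·μ(f) + λ(f)} · #(F/gF)`; hence `p^{deg g·μ+λ} ∣ #(X/gX)`, equality iff `X` has no non-zero finite submodule, and the
# ONE-SIDED `μ = 0` CERTIFICATE `#(X/Ψ_n X) < p^{φ(p^{n+1})} ⟹ μ = 0` — an inequality, no hypothesis on finite submodules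

HONEST FRAMING (cell `bsd-f1-sign2`, WIDTH-5 attached prover seat `bsd-line-att-p5` gen 55 on line `birth` of the lead `bsd-line-att-p2`;
`--supports` stmt-BirchSwinnertonDyer-22298, closes nothing; BSD is NOT proved by any of this; the crux C2, its verdict «blocked-on
`Rank1Residual.GreenbergMuConjectureIrreducible`» and every registered stub (P / T / Kμ / LimDoor / MuIneqʳ / PFμ⁺) are untouched). THEOREMS ONLY —
pure commutative algebra over `Λ = ℤ_p⟦T⟧`, any prime `p`; no `def`, no instance, no named fact, no `sorry`. Sequel of g54's `…HalfDescentLayerIndexModule`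
(★★★ `natCard_quotient_smul_top_eq_pow`: `#(X/gX) = p^{deg g·μ(f)+λ(f)}` for `X` WITHOUT non-zero finite submodule) and `…HalfDescentLayerIndexTower`
(`coe_smul_eq_zero_imp`: an Eisenstein `g ∤ f` is `X`-regular on such `X`). Lineage glue on g54's successor (3) «the `μ`-side in index form», kernel half:
g54's datum theorems carry the DISPLAYED binder `hnf` («`X(E/ℚ_∞)` has no non-zero finite `Λ`-submodule», Greenberg's Prop. 4.14–4.15); THIS FILE removes it
from the `μ`-half by carrying the largest finite submodule `F` of `X` (tree: `IwasawaAlgebra.exists_finite_submodule_forall_finite_le`,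
`forall_finite_eq_bot_quotient_of_forall_finite_le`) through the layer index.

THE POINT. `X' = X/F` has no non-zero finite submodule, is finitely generated torsion, and `char_Λ X' = char_Λ X` (`char` is multiplicative, `char F = Λ`
for finite `F`: tree `charIdeal_mul_of_shortExact_holds`, `Module.charIdeal_eq_top_of_isPseudoNull`, `isPseudoNull_of_finite`). An Eisenstein `g ∤ f` is
`X'`-regular, so `F ∩ gX = gF` and `0 → F/gF → X/gX → X'/gX' → 0` is exact:
* §1 (any commutative ring) `natCard_quotient_smul_top_eq_mul_of_quotient_regular`: `a` regular on `M/F` ⟹ **`#(M/aM) = #((M/F)/a(M/F)) · #(F/aF)`**.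
* §2 (`Λ`, Eisenstein distinguished `g`, `λ(f) < deg g`) ★★★ **`natCard_quotient_smul_top_eq_pow_mul`: `#(X/gX) = p^{deg g·μ(f)+λ(f)} · #(F/gF)`** for ANY
  finite `F ≤ X` with `X/F` free of finite submodules (= the largest finite submodule); ★★ `pow_dvd_natCard_quotient_smul_top` (**`p^{deg g·μ+λ} ∣ #(X/gX)`**,
  `F` eliminated), `finite_quotient_smul_top'`, `natCard_quotient_smul_top_le` (`≤ p^{deg g·μ+λ}·#F`); ★★ **`natCard_quotient_smul_top_eq_pow_iff`:
  `#(X/gX) = p^{deg g·μ+λ} ⟺ X has no non-zero finite submodule`** (Nakayama: `#(F/gF) = 1 ⟹ F = gF ⟹ F = 0`) — the descent number DETECTS the finite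
  submodule; ★★★ **`mu_eq_zero_of_natCard_quotient_smul_top_lt`: `#(X/gX) < p^{deg g} ⟹ μ(f) = 0`** — ONE-SIDED, an INEQUALITY, NO `hnf`.
* §3 (`g = Ψ_n = Φ_{p^{n+1}}(1+T)`, `φ = pⁿ(p−1) > λ(f)`): `natCard_layerQuotient_eq_pow_mul`, `pow_dvd_natCard_layerQuotient`, `natCard_layerQuotient_eq_pow_iff`,
  ★★★ **`mu_eq_zero_of_natCard_layerQuotient_lt`: `#(X/Ψ_n X) < p^{pⁿ(p−1)}` at ONE layer with `λ(f) < pⁿ(p−1)` ⟹ `μ(f) = 0`**, for EVERY f.g. torsion `X`.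
Reading for C2 (whose open input is Greenberg's `μ = 0` at `2`): the `μ`-half of g54's «MC at the datum ⟺ one descent number» needs neither Greenberg 4.14
(`hnf`) nor an exact count: an UPPER BOUND `#(X/Ψ_n X) < 2^{2ⁿ}` at one layer suffices — and an upper bound is what a descent delivers. Sequel
`…HalfDescentLayerIndexFiniteSelmer`: the same in `Sel_{p^∞}(E/K_∞)`-currency and at the C2 datum. Memo `Cruxes/MainConjectureOfRankZeroBSDAtTwo/LAYER-INDEX-FINITE-att-p5-g55.md`.
BSD is not proved by any of this; nothing about any curve is asserted here.

References: L. Washington, GTM 83, §13.2 (Lemma 13.7, Nakayama), §13.3 (Lemmas 13.18–13.21, Thm. 13.13: `e_n = μpⁿ + λn + ν`) [Washington1997]; J. Neukirch,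
A. Schmidt, K. Wingberg, *Cohomology of Number Fields*, (5.1.4) Remark 4, (5.3.1), (5.3.17) [NeukirchSchmidtWingberg2008]; R. Greenberg, LNM 1716 (1999), §4
p. 117 and Prop. 4.14–4.15 [GreenbergLNM1716]; D. Delbourgo, *Elliptic Curves and Big Galois Representations* (2008), App. C pp. 350–352 [Delbourgo2008].
-/

set_option linter.dupNamespace false
set_option autoImplicit false

noncomputable section

open scoped Classical Polynomial

namespace Summit.BirchSwinnertonDyer.BirchSwinnertonDyer.Theorems.AlignedTransportAtTwoHalfDescentLayerIndexFinite

open Literature.NumberTheory.EllipticCurves Literature.NumberTheory.EllipticCurves.IwasawaAlgebra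
  Summit.BirchSwinnertonDyer.Rank1Residual.X1.MuLambda
  Summit.BirchSwinnertonDyer.Rank1Residual.X1.ParitySqueeze
  Summit.BirchSwinnertonDyer.Rank1Residual.X1.GeneratorBoundMu
  Summit.BirchSwinnertonDyer.Rank1Residual.Iwasawa
  Summit.BirchSwinnertonDyer.BirchSwinnertonDyer.Theorems.DefectPrime
  Summit.BirchSwinnertonDyer.BirchSwinnertonDyer.Theorems.AlignedTransportAtTwoCyclotomicLayerPrime
  Summit.BirchSwinnertonDyer.BirchSwinnertonDyer.Theorems.AlignedTransportAtTwoHalfDescentLayerRing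
  Summit.BirchSwinnertonDyer.BirchSwinnertonDyer.Theorems.AlignedTransportAtTwoHalfDescentLayerIndex
  Summit.BirchSwinnertonDyer.BirchSwinnertonDyer.Theorems.AlignedTransportAtTwoHalfDescentLayerIndexModule
  Summit.BirchSwinnertonDyer.BirchSwinnertonDyer.Theorems.AlignedTransportAtTwoHalfDescentLayerIndexTower

universe u

/-! ## §1 `#(M/aM) = #((M/F)/a(M/F)) · #(F/aF)` when `a` is regular on `M/F` (any commutative ring) -/

section Ring

variable {R : Type*} [CommRing R] {M : Type*} [AddCommGroup M] [Module R M]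

/-- **The layer quotient along `0 → F → M → M/F → 0`.** If `a ∈ R` acts injectively on `M/F`, then `F ∩ aM = aF` and
`0 → F/aF → M/aM → (M/F)/a(M/F) → 0` is exact, so **`#(M/aM) = #((M/F)/a(M/F)) · #(F/aF)`** (`Nat.card`, valid verbatim when a factor is infinite).
[cite: Washington1997, §13.3 (Lemma 13.18 and the proof of Thm. 13.13)] [cite: NeukirchSchmidtWingberg2008, (5.3.1)] -/
theorem natCard_quotient_smul_top_eq_mul_of_quotient_regular (F : Submodule R M) (a : R) (ha : ∀ x : M ⧸ F, a • x = 0 → x = 0) :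
    Nat.card (M ⧸ (Ideal.span {a} • ⊤ : Submodule R M)) =
      Nat.card ((M ⧸ F) ⧸ (Ideal.span {a} • ⊤ : Submodule R (M ⧸ F))) * Nat.card (F ⧸ (Ideal.span {a} • ⊤ : Submodule R F)) := by
  set A : Submodule R M := Ideal.span {a} • ⊤ with hA
  have hmemA : ∀ x : M, x ∈ A ↔ ∃ y : M, x = a • y := fun x ↦ by
    rw [hA, Submodule.ideal_span_singleton_smul, Submodule.mem_smul_pointwise_iff_exists]
    exact ⟨fun ⟨y, _, h⟩ ↦ ⟨y, h.symm⟩, fun ⟨y, h⟩ ↦ ⟨y, Submodule.mem_top, h.symm⟩⟩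
  have hmemF : ∀ x : F, x ∈ (Ideal.span {a} • ⊤ : Submodule R F) ↔ ∃ y : F, x = a • y := fun x ↦ by
    rw [Submodule.ideal_span_singleton_smul, Submodule.mem_smul_pointwise_iff_exists]
    exact ⟨fun ⟨y, _, h⟩ ↦ ⟨y, h.symm⟩, fun ⟨y, h⟩ ↦ ⟨y, Submodule.mem_top, h.symm⟩⟩
  -- (1) the image of `F` in `M/A` is `F/aF`: the kernel of `F → M/A` is `F ∩ A = aF` by regularity of `a` on `M/F`
  set ι : F →ₗ[R] M ⧸ A := A.mkQ.comp F.subtype with hι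
  have hι_range : LinearMap.range ι = F.map A.mkQ := by rw [hι, LinearMap.range_comp, Submodule.range_subtype]
  have hι_ker : LinearMap.ker ι = (Ideal.span {a} • ⊤ : Submodule R F) := by
    ext x
    rw [LinearMap.mem_ker, hι, LinearMap.comp_apply, Submodule.mkQ_apply, Submodule.Quotient.mk_eq_zero, Submodule.subtype_apply, hmemA, hmemF]
    constructor
    · rintro ⟨y, hy⟩
      -- `a·ȳ = 0` in `M/F`, so `y ∈ F`
      have hy0 : a • (F.mkQ y) = 0 := by
        rw [← map_smul, ← hy, Submodule.mkQ_apply, Submodule.Quotient.mk_eq_zero]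
        exact x.2
      have hyF : y ∈ F := by
        have h := ha _ hy0
        rwa [Submodule.mkQ_apply, Submodule.Quotient.mk_eq_zero] at h
      exact ⟨⟨y, hyF⟩, Subtype.ext hy⟩
    · rintro ⟨y, rfl⟩
      exact ⟨(y : M), rfl⟩
  have hcardF : Nat.card ↥(F.map A.mkQ) = Nat.card (F ⧸ (Ideal.span {a} • ⊤ : Submodule R F)) := by
    rw [← hι_range, ← Nat.card_congr ι.quotKerEquivRange.toEquiv, Nat.card_congr (Submodule.quotEquivOfEq _ _ hι_ker).toEquiv]
  -- (2) `(M/A)/(image of F) ≅ M/(A ⊔ F) ≅ (M/F)/a(M/F)`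
  have hmapA : (A ⊔ F).map A.mkQ = F.map A.mkQ := by rw [Submodule.map_sup, Submodule.mkQ_map_self, bot_sup_eq]
    -- (`map A.mkQ A = ⊥`)
  have hmapF : (A ⊔ F).map F.mkQ = (Ideal.span {a} • ⊤ : Submodule R (M ⧸ F)) := by
    rw [Submodule.map_sup, Submodule.mkQ_map_self, sup_bot_eq, hA, Submodule.map_smul'', Submodule.map_top,
      Submodule.range_mkQ]
  have hcardQ : Nat.card ((M ⧸ A) ⧸ F.map A.mkQ) = Nat.card ((M ⧸ F) ⧸ (Ideal.span {a} • ⊤ : Submodule R (M ⧸ F))) := by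
    rw [← Nat.card_congr (Submodule.quotEquivOfEq _ _ hmapA).toEquiv, Nat.card_congr (Submodule.quotientQuotientEquivQuotient A (A ⊔ F) le_sup_left).toEquiv,
      ← Nat.card_congr (Submodule.quotientQuotientEquivQuotient F (A ⊔ F) le_sup_right).toEquiv, Nat.card_congr (Submodule.quotEquivOfEq _ _ hmapF).toEquiv]
  rw [Submodule.card_eq_card_quotient_mul_card (F.map A.mkQ), hcardQ, hcardF, mul_comm]

/-- A surjection reads the layer quotient from above: **`#((M/F)/a(M/F)) ∣ #(M/aM)`** for every submodule `F` and every `a` (no regularity; `Nat.card`).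
[cite: Washington1997, §13.3] -/
theorem natCard_quotient_quotient_smul_top_dvd (F : Submodule R M) (a : R) :
    Nat.card ((M ⧸ F) ⧸ (Ideal.span {a} • ⊤ : Submodule R (M ⧸ F))) ∣ Nat.card (M ⧸ (Ideal.span {a} • ⊤ : Submodule R M)) := by
  set A : Submodule R M := Ideal.span {a} • ⊤ with hA
  have hmapF : (A ⊔ F).map F.mkQ = (Ideal.span {a} • ⊤ : Submodule R (M ⧸ F)) := by
    rw [Submodule.map_sup, Submodule.mkQ_map_self, sup_bot_eq, hA, Submodule.map_smul'', Submodule.map_top,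
      Submodule.range_mkQ]
  have hcardQ : Nat.card ((M ⧸ A) ⧸ (A ⊔ F).map A.mkQ) = Nat.card ((M ⧸ F) ⧸ (Ideal.span {a} • ⊤ : Submodule R (M ⧸ F))) := by
    rw [Nat.card_congr (Submodule.quotientQuotientEquivQuotient A (A ⊔ F) le_sup_left).toEquiv,
      ← Nat.card_congr (Submodule.quotientQuotientEquivQuotient F (A ⊔ F) le_sup_right).toEquiv, Nat.card_congr (Submodule.quotEquivOfEq _ _ hmapF).toEquiv]
  rw [Submodule.card_eq_card_quotient_mul_card ((A ⊔ F).map A.mkQ), hcardQ]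
  exact Dvd.intro_left _ rfl

end Ring

/-! ## §2 `#(X/gX) = p^{deg g·μ(f) + λ(f)} · #(F/gF)` for ANY finitely generated torsion `X` with `char_Λ X = (f)`, `λ(f) < deg g` -/

section Eisenstein

variable {p : ℕ} [hp : Fact p.Prime] {M : Type u} [AddCommGroup M] [Module (IwasawaAlgebra p) M] {g : ℤ_[p][X]}

/-- **`char_Λ (X/F) = char_Λ X` for a finite submodule `F`** of a finitely generated torsion `Λ`-module (`char` is multiplicative and `char F = Λ` for
finite = pseudo-null `F`), together with: `X/F` is torsion. [cite: NeukirchSchmidtWingberg2008, (5.1.4) Remark 4 and (5.3.1)] [cite: Washington1997, §13.2] -/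
theorem isTorsion_and_charIdeal_quotient_eq [Module.Finite (IwasawaAlgebra p) M] (hM : Module.IsTorsion (IwasawaAlgebra p) M)
    (F : Submodule (IwasawaAlgebra p) M) [Finite F] :
    Module.IsTorsion (IwasawaAlgebra p) (M ⧸ F) ∧
      Literature.NumberTheory.EllipticCurves.Module.charIdeal (IwasawaAlgebra p) (M ⧸ F) =
        Literature.NumberTheory.EllipticCurves.Module.charIdeal (IwasawaAlgebra p) M := by
  refine ⟨Literature.NumberTheory.EllipticCurves.isTorsion_of_surjective F.mkQ (Submodule.mkQ_surjective _) hM, ?_⟩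
  have hmul := charIdeal_mul_of_shortExact_holds p M hM F.subtype F.mkQ (Submodule.injective_subtype _) (Submodule.mkQ_surjective _)
    (LinearMap.exact_subtype_mkQ _)
  rw [Module.charIdeal_eq_top_of_isPseudoNull (isPseudoNull_of_finite p F), Ideal.top_mul] at hmul
  exact hmul.symm

/-- ★★★ **THE LAYER INDEX WITH A FINITE SUBMODULE.** `g ∈ ℤ_p[T]` Eisenstein distinguished (`g(0) = p`, prime in `Λ`); `X` ANY finitely generated torsion
`Λ`-module with `char_Λ X = (f)`; `F ≤ X` a finite submodule such that `X/F` has no non-zero finite submodule (i.e. `F` is the largest finite submodule);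
`λ(f) < deg g`. Then **`#(X/gX) = p^{deg g·μ(f) + λ(f)} · #(F/gF)`**: g54's exact index for `X/F` (`char (X/F) = char X`), and `0 → F/gF → X/gX → (X/F)/g(X/F) → 0`
(`g` is `X/F`-regular since `g ∤ f`, `Λ/(f, g)` finite). Iwasawa's `ν`-term at the layer, in index form: the finite submodule contributes EXACTLY `#(F/gF)`.
[cite: Washington1997, §13.3 (Lemmas 13.18–13.21, Thm. 13.13)] [cite: NeukirchSchmidtWingberg2008, (5.3.1) and (5.3.17)] [cite: GreenbergLNM1716, §4 p. 117] -/
theorem natCard_quotient_smul_top_eq_pow_mul (hg : g.IsDistinguishedAt (IsLocalRing.maximalIdeal ℤ_[p]))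
    (hg0 : PowerSeries.constantCoeff (g : IwasawaAlgebra p) = p) (hgp : Prime (g : IwasawaAlgebra p)) [Module.Finite (IwasawaAlgebra p) M]
    (hM : Module.IsTorsion (IwasawaAlgebra p) M) (F : Submodule (IwasawaAlgebra p) M) [Finite F]
    (hF : ∀ N : Submodule (IwasawaAlgebra p) (M ⧸ F), Finite N → N = ⊥) {f : IwasawaAlgebra p}
    (hchar : Literature.NumberTheory.EllipticCurves.Module.charIdeal (IwasawaAlgebra p) M = Ideal.span {f}) (hlam : lam f < g.natDegree) :
    Nat.card (M ⧸ (Ideal.span {(g : IwasawaAlgebra p)} • ⊤ : Submodule (IwasawaAlgebra p) M)) =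
      p ^ (g.natDegree * mu f + lam f) * Nat.card (F ⧸ (Ideal.span {(g : IwasawaAlgebra p)} • ⊤ : Submodule (IwasawaAlgebra p) F)) := by
  obtain ⟨hM', hchar'⟩ := isTorsion_and_charIdeal_quotient_eq hM F
  rw [hchar] at hchar'
  -- `f ≠ 0`, `g ∤ f`
  obtain ⟨f', hf'0, hcharf'⟩ := exists_charGenerator_ne_zero (M ⧸ F) hM'
  have hf0 : f ≠ 0 := by
    intro h
    rw [hcharf', h, Ideal.span_singleton_eq_span_singleton] at hchar'
    exact hf'0 (associated_zero_iff_eq_zero _ |>.mp hchar')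
  have hgf : ¬ (g : IwasawaAlgebra p) ∣ f := by
    rintro ⟨q, hq⟩
    have hq0 : q ≠ 0 := fun h ↦ hf0 (by rw [hq, h, mul_zero])
    have h := lam_mul hgp.ne_zero hq0
    rw [← hq, lam_coe_eq_natDegree hg] at h
    omega
  -- `g` is `X/F`-regular
  have hkill : ∀ x : M ⧸ F, f • x = 0 := smul_eq_zero_of_charIdeal_eq_span_of_noFiniteSubmodule p (M ⧸ F) hM' hF hchar'
  have hreg : ∀ x : M ⧸ F, (g : IwasawaAlgebra p) • x = 0 → x = 0 := coe_smul_eq_zero_imp hF hkill hg0 hgp hgf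
  rw [natCard_quotient_smul_top_eq_mul_of_quotient_regular F (g : IwasawaAlgebra p) hreg,
    natCard_quotient_smul_top_eq_pow (M := M ⧸ F) hg hg0 hgp hM' hF hchar' hlam]

/-- ★★ **`p^{deg g·μ(f) + λ(f)} ∣ #(X/gX)` for EVERY finitely generated torsion `X`** with `char_Λ X = (f)`, `λ(f) < deg g` (the largest finite submodule exists:
tree `exists_finite_submodule_forall_finite_le`; then the previous theorem). [cite: Washington1997, §13.3 (Thm. 13.13)] [cite: NeukirchSchmidtWingberg2008, (5.3.1)] -/
theorem pow_dvd_natCard_quotient_smul_top (hg : g.IsDistinguishedAt (IsLocalRing.maximalIdeal ℤ_[p]))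
    (hg0 : PowerSeries.constantCoeff (g : IwasawaAlgebra p) = p) (hgp : Prime (g : IwasawaAlgebra p)) [Module.Finite (IwasawaAlgebra p) M]
    (hM : Module.IsTorsion (IwasawaAlgebra p) M) {f : IwasawaAlgebra p}
    (hchar : Literature.NumberTheory.EllipticCurves.Module.charIdeal (IwasawaAlgebra p) M = Ideal.span {f}) (hlam : lam f < g.natDegree) :
    p ^ (g.natDegree * mu f + lam f) ∣ Nat.card (M ⧸ (Ideal.span {(g : IwasawaAlgebra p)} • ⊤ : Submodule (IwasawaAlgebra p) M)) := by
  haveI : IsNoetherian (IwasawaAlgebra p) M := inferInstance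
  obtain ⟨F, hFfin, hFmax⟩ := exists_finite_submodule_forall_finite_le (R := IwasawaAlgebra p) (M := M)
  haveI : Finite F := hFfin
  rw [natCard_quotient_smul_top_eq_pow_mul hg hg0 hgp hM F (forall_finite_eq_bot_quotient_of_forall_finite_le F hFmax) hchar hlam]
  exact Dvd.intro _ rfl

/-- `X/gX` is FINITE for every finitely generated torsion `X` with `char_Λ X = (f)`, `λ(f) < deg g` (finite submodules allowed).
[cite: Washington1997, §13.3 (Lemma 13.18)] -/
theorem finite_quotient_smul_top' (hg : g.IsDistinguishedAt (IsLocalRing.maximalIdeal ℤ_[p]))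
    (hg0 : PowerSeries.constantCoeff (g : IwasawaAlgebra p) = p) (hgp : Prime (g : IwasawaAlgebra p)) [Module.Finite (IwasawaAlgebra p) M]
    (hM : Module.IsTorsion (IwasawaAlgebra p) M) {f : IwasawaAlgebra p}
    (hchar : Literature.NumberTheory.EllipticCurves.Module.charIdeal (IwasawaAlgebra p) M = Ideal.span {f}) (hlam : lam f < g.natDegree) :
    Finite (M ⧸ (Ideal.span {(g : IwasawaAlgebra p)} • ⊤ : Submodule (IwasawaAlgebra p) M)) := by
  haveI : IsNoetherian (IwasawaAlgebra p) M := inferInstance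
  obtain ⟨F, hFfin, hFmax⟩ := exists_finite_submodule_forall_finite_le (R := IwasawaAlgebra p) (M := M)
  haveI : Finite F := hFfin
  haveI : Finite (F ⧸ (Ideal.span {(g : IwasawaAlgebra p)} • ⊤ : Submodule (IwasawaAlgebra p) F)) :=
    Finite.of_surjective _ (Submodule.mkQ_surjective _)
  apply Nat.finite_of_card_ne_zero
  rw [natCard_quotient_smul_top_eq_pow_mul hg hg0 hgp hM F (forall_finite_eq_bot_quotient_of_forall_finite_le F hFmax) hchar hlam]
  exact mul_ne_zero (pow_ne_zero _ hp.out.ne_zero) Nat.card_pos.ne'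

/-- **`p^{deg g·μ+λ} ≤ #(X/gX) ≤ p^{deg g·μ+λ} · #F`** with `F` any finite submodule whose quotient has no finite submodule (`#(F/gF) ≤ #F`).
[cite: Washington1997, §13.3 (Thm. 13.13: the constant ν)] -/
theorem natCard_quotient_smul_top_le (hg : g.IsDistinguishedAt (IsLocalRing.maximalIdeal ℤ_[p]))
    (hg0 : PowerSeries.constantCoeff (g : IwasawaAlgebra p) = p) (hgp : Prime (g : IwasawaAlgebra p)) [Module.Finite (IwasawaAlgebra p) M]
    (hM : Module.IsTorsion (IwasawaAlgebra p) M) (F : Submodule (IwasawaAlgebra p) M) [Finite F]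
    (hF : ∀ N : Submodule (IwasawaAlgebra p) (M ⧸ F), Finite N → N = ⊥) {f : IwasawaAlgebra p}
    (hchar : Literature.NumberTheory.EllipticCurves.Module.charIdeal (IwasawaAlgebra p) M = Ideal.span {f}) (hlam : lam f < g.natDegree) :
    p ^ (g.natDegree * mu f + lam f) ≤ Nat.card (M ⧸ (Ideal.span {(g : IwasawaAlgebra p)} • ⊤ : Submodule (IwasawaAlgebra p) M)) ∧
    Nat.card (M ⧸ (Ideal.span {(g : IwasawaAlgebra p)} • ⊤ : Submodule (IwasawaAlgebra p) M)) ≤ p ^ (g.natDegree * mu f + lam f) * Nat.card F := by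
  haveI : Finite (F ⧸ (Ideal.span {(g : IwasawaAlgebra p)} • ⊤ : Submodule (IwasawaAlgebra p) F)) :=
    Finite.of_surjective _ (Submodule.mkQ_surjective _)
  rw [natCard_quotient_smul_top_eq_pow_mul hg hg0 hgp hM F hF hchar hlam]
  refine ⟨Nat.le_mul_of_pos_right _ Nat.card_pos, Nat.mul_le_mul_left _ ?_⟩
  exact Nat.card_le_card_of_surjective _ (Submodule.mkQ_surjective _)

/-- ★★ **THE DESCENT NUMBER DETECTS THE FINITE SUBMODULE: `#(X/gX) = p^{deg g·μ(f) + λ(f)} ⟺ X has no non-zero finite submodule`** (`X` f.g. torsion,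
`char_Λ X = (f)`, `λ(f) < deg g`). `⟸` is g54's exact index; `⟹`: `#(F/gF) = 1` for the largest finite submodule `F`, so `F = gF` and `F = 0` by Nakayama
(`g ∈ 𝔪_Λ`). [cite: Washington1997, §13.2 (Lemma 13.16, Nakayama) and §13.3 (Thm. 13.13)] [cite: GreenbergLNM1716, Prop. 4.14–4.15] -/
theorem natCard_quotient_smul_top_eq_pow_iff (hg : g.IsDistinguishedAt (IsLocalRing.maximalIdeal ℤ_[p]))
    (hg0 : PowerSeries.constantCoeff (g : IwasawaAlgebra p) = p) (hgp : Prime (g : IwasawaAlgebra p)) [Module.Finite (IwasawaAlgebra p) M]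
    (hM : Module.IsTorsion (IwasawaAlgebra p) M) {f : IwasawaAlgebra p}
    (hchar : Literature.NumberTheory.EllipticCurves.Module.charIdeal (IwasawaAlgebra p) M = Ideal.span {f}) (hlam : lam f < g.natDegree) :
    Nat.card (M ⧸ (Ideal.span {(g : IwasawaAlgebra p)} • ⊤ : Submodule (IwasawaAlgebra p) M)) = p ^ (g.natDegree * mu f + lam f) ↔
      ∀ N : Submodule (IwasawaAlgebra p) M, Finite N → N = ⊥ := by
  refine ⟨fun hcard ↦ ?_, fun hnf ↦ natCard_quotient_smul_top_eq_pow hg hg0 hgp hM hnf hchar hlam⟩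
  haveI : IsNoetherian (IwasawaAlgebra p) M := inferInstance
  obtain ⟨F, hFfin, hFmax⟩ := exists_finite_submodule_forall_finite_le (R := IwasawaAlgebra p) (M := M)
  haveI : Finite F := hFfin
  haveI : Finite (F ⧸ (Ideal.span {(g : IwasawaAlgebra p)} • ⊤ : Submodule (IwasawaAlgebra p) F)) :=
    Finite.of_surjective _ (Submodule.mkQ_surjective _)
  rw [natCard_quotient_smul_top_eq_pow_mul hg hg0 hgp hM F (forall_finite_eq_bot_quotient_of_forall_finite_le F hFmax) hchar hlam] at hcard
  have hone : Nat.card (F ⧸ (Ideal.span {(g : IwasawaAlgebra p)} • ⊤ : Submodule (IwasawaAlgebra p) F)) = 1 := by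
    have hpow : p ^ (g.natDegree * mu f + lam f) ≠ 0 := pow_ne_zero _ hp.out.ne_zero
    have h := hcard
    conv_rhs at h => rw [← mul_one (p ^ (g.natDegree * mu f + lam f))]
    exact Nat.eq_of_mul_eq_mul_left (Nat.pos_of_ne_zero hpow) h
  -- `F/gF = 0`, i.e. `⊤ ≤ g•⊤` in `F`; Nakayama
  have htop : (⊤ : Submodule (IwasawaAlgebra p) F) ≤ Ideal.span {(g : IwasawaAlgebra p)} • ⊤ := by
    intro x _
    have hsub : Subsingleton (F ⧸ (Ideal.span {(g : IwasawaAlgebra p)} • ⊤ : Submodule (IwasawaAlgebra p) F)) :=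
      (Nat.card_eq_one_iff_unique.mp hone).1
    rw [← Submodule.Quotient.mk_eq_zero]
    exact Subsingleton.elim _ _
  have hjac : Ideal.span {(g : IwasawaAlgebra p)} ≤ Ideal.jacobson ⊥ := by
    rw [IsLocalRing.jacobson_eq_maximalIdeal ⊥ bot_ne_top, Ideal.span_le, Set.singleton_subset_iff]
    exact (IsLocalRing.mem_maximalIdeal _).mpr hgp.not_unit
  have hFG : (⊤ : Submodule (IwasawaAlgebra p) F).FG := Module.Finite.fg_top
  have hbot : (⊤ : Submodule (IwasawaAlgebra p) F) = ⊥ := Submodule.eq_bot_of_le_smul_of_le_jacobson_bot _ _ hFG htop hjac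
  have hF0 : F = ⊥ := by
    rw [eq_bot_iff]
    intro x hx
    have hx' : (⟨x, hx⟩ : F) ∈ (⊤ : Submodule (IwasawaAlgebra p) F) := Submodule.mem_top
    rw [hbot, Submodule.mem_bot] at hx'
    rw [Submodule.mem_bot]
    exact congrArg Subtype.val hx'
  intro N hN
  have hle := hFmax N hN
  rw [hF0] at hle
  exact le_bot_iff.mp hle

/-- ★★★ **ONE-SIDED `μ = 0` CERTIFICATE, NO HYPOTHESIS ON FINITE SUBMODULES: `#(X/gX) < p^{deg g} ⟹ μ(f) = 0`** (`X` ANY f.g. torsion `Λ`-module,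
`char_Λ X = (f)`, `λ(f) < deg g`, `g` Eisenstein distinguished): `p^{deg g·μ(f)} ∣ p^{deg g·μ+λ} ∣ #(X/gX) ≠ 0`. An INEQUALITY — an upper bound on one
layer index — certifies Greenberg's `μ = 0` for the module. [cite: Washington1997, §13.3 (Thm. 13.13)] [cite: GreenbergLNM1716, Conj. 1.11] -/
theorem mu_eq_zero_of_natCard_quotient_smul_top_lt (hg : g.IsDistinguishedAt (IsLocalRing.maximalIdeal ℤ_[p]))
    (hg0 : PowerSeries.constantCoeff (g : IwasawaAlgebra p) = p) (hgp : Prime (g : IwasawaAlgebra p)) [Module.Finite (IwasawaAlgebra p) M]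
    (hM : Module.IsTorsion (IwasawaAlgebra p) M) {f : IwasawaAlgebra p}
    (hchar : Literature.NumberTheory.EllipticCurves.Module.charIdeal (IwasawaAlgebra p) M = Ideal.span {f}) (hlam : lam f < g.natDegree)
    (hlt : Nat.card (M ⧸ (Ideal.span {(g : IwasawaAlgebra p)} • ⊤ : Submodule (IwasawaAlgebra p) M)) < p ^ g.natDegree) : mu f = 0 := by
  have hdvd := pow_dvd_natCard_quotient_smul_top hg hg0 hgp hM hchar hlam
  haveI := finite_quotient_smul_top' hg hg0 hgp hM hchar hlam
  have hpos : 0 < Nat.card (M ⧸ (Ideal.span {(g : IwasawaAlgebra p)} • ⊤ : Submodule (IwasawaAlgebra p) M)) := Nat.card_pos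
  have hle := (Nat.le_of_dvd hpos hdvd).trans_lt hlt
  have hexp := (Nat.pow_lt_pow_iff_right hp.out.one_lt).mp hle
  by_contra hμ
  have h1 : 1 ≤ mu f := Nat.one_le_iff_ne_zero.mpr hμ
  have : g.natDegree ≤ g.natDegree * mu f + lam f := by nlinarith
  omega

/-- With NO finite submodule the certificate is two-sided: **`μ(f) = 0 ⟺ #(X/gX) < p^{deg g}`** (the index is `p^{deg g·μ+λ}` and `λ < deg g`).
[cite: Washington1997, §13.3 (Thm. 13.13)] -/
theorem mu_eq_zero_iff_natCard_quotient_smul_top_lt (hg : g.IsDistinguishedAt (IsLocalRing.maximalIdeal ℤ_[p]))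
    (hg0 : PowerSeries.constantCoeff (g : IwasawaAlgebra p) = p) (hgp : Prime (g : IwasawaAlgebra p)) [Module.Finite (IwasawaAlgebra p) M]
    (hM : Module.IsTorsion (IwasawaAlgebra p) M) (hnf : ∀ N : Submodule (IwasawaAlgebra p) M, Finite N → N = ⊥) {f : IwasawaAlgebra p}
    (hchar : Literature.NumberTheory.EllipticCurves.Module.charIdeal (IwasawaAlgebra p) M = Ideal.span {f}) (hlam : lam f < g.natDegree) :
    mu f = 0 ↔ Nat.card (M ⧸ (Ideal.span {(g : IwasawaAlgebra p)} • ⊤ : Submodule (IwasawaAlgebra p) M)) < p ^ g.natDegree := by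
  refine ⟨fun hμ ↦ ?_, mu_eq_zero_of_natCard_quotient_smul_top_lt hg hg0 hgp hM hchar hlam⟩
  rw [natCard_quotient_smul_top_eq_pow hg hg0 hgp hM hnf hchar hlam, hμ, mul_zero, zero_add]
  exact Nat.pow_lt_pow_right hp.out.one_lt hlam

end Eisenstein

/-! ## §3 The layer quotients `X/Ψ_n X`: `#(X/Ψ_n X) = p^{pⁿ(p−1)μ + λ} · #(F/Ψ_n F)`; `#(X/Ψ_n X) < p^{pⁿ(p−1)} ⟹ μ = 0` -/

section Layer

variable {p : ℕ} [hp : Fact p.Prime] {M : Type u} [AddCommGroup M] [Module (IwasawaAlgebra p) M]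

/-- ★★★ **THE LAYER INDEX OF A GENERAL IWASAWA MODULE.** `X` ANY finitely generated torsion `Λ`-module, `char_Λ X = (f)`, `F ≤ X` finite with `X/F` free of
finite submodules (the largest finite submodule); for every `n` with `λ(f) < pⁿ(p−1)`: **`#(X/Ψ_n X) = p^{pⁿ(p−1)·μ(f) + λ(f)} · #(F/Ψ_n F)`**,
`Ψ_n = Φ_{p^{n+1}}(1+T)` — Iwasawa's `e_{n+1} − e_n` with its `ν`-contribution made explicit and exact. [cite: Washington1997, §13.3 (Thm. 13.13)]
[cite: NeukirchSchmidtWingberg2008, (5.3.17)] -/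
theorem natCard_layerQuotient_eq_pow_mul [Module.Finite (IwasawaAlgebra p) M] (hM : Module.IsTorsion (IwasawaAlgebra p) M)
    (F : Submodule (IwasawaAlgebra p) M) [Finite F] (hF : ∀ N : Submodule (IwasawaAlgebra p) (M ⧸ F), Finite N → N = ⊥) {f : IwasawaAlgebra p}
    (hchar : Literature.NumberTheory.EllipticCurves.Module.charIdeal (IwasawaAlgebra p) M = Ideal.span {f}) {n : ℕ} (hlam : lam f < p ^ n * (p - 1)) :
    Nat.card (M ⧸ (Ideal.span {(((Polynomial.cyclotomic (p ^ (n + 1)) ℤ_[p]).comp (Polynomial.X + 1) : ℤ_[p][X]) : IwasawaAlgebra p)} • ⊤ :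
      Submodule (IwasawaAlgebra p) M)) =
      p ^ (p ^ n * (p - 1) * mu f + lam f) *
        Nat.card (F ⧸ (Ideal.span {(((Polynomial.cyclotomic (p ^ (n + 1)) ℤ_[p]).comp (Polynomial.X + 1) : ℤ_[p][X]) : IwasawaAlgebra p)} • ⊤ :
          Submodule (IwasawaAlgebra p) F)) := by
  rw [← natDegree_cyclotomicLayer p n] at hlam ⊢
  exact natCard_quotient_smul_top_eq_pow_mul (cyclotomic_comp_isDistinguishedAt_maximalIdeal p n) (constantCoeff_cyclotomicLayer p n)
    (prime_coe_cyclotomic_comp p n) hM F hF hchar hlam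

/-- ★★ **`p^{pⁿ(p−1)·μ(f) + λ(f)} ∣ #(X/Ψ_n X)`** for EVERY f.g. torsion `X` with `char_Λ X = (f)` and every `n` with `λ(f) < pⁿ(p−1)`; and `X/Ψ_n X` is finite.
[cite: Washington1997, §13.3 (Thm. 13.13)] -/
theorem pow_dvd_natCard_layerQuotient [Module.Finite (IwasawaAlgebra p) M] (hM : Module.IsTorsion (IwasawaAlgebra p) M) {f : IwasawaAlgebra p}
    (hchar : Literature.NumberTheory.EllipticCurves.Module.charIdeal (IwasawaAlgebra p) M = Ideal.span {f}) {n : ℕ} (hlam : lam f < p ^ n * (p - 1)) :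
    p ^ (p ^ n * (p - 1) * mu f + lam f) ∣
      Nat.card (M ⧸ (Ideal.span {(((Polynomial.cyclotomic (p ^ (n + 1)) ℤ_[p]).comp (Polynomial.X + 1) : ℤ_[p][X]) : IwasawaAlgebra p)} • ⊤ :
        Submodule (IwasawaAlgebra p) M)) ∧
    Finite (M ⧸ (Ideal.span {(((Polynomial.cyclotomic (p ^ (n + 1)) ℤ_[p]).comp (Polynomial.X + 1) : ℤ_[p][X]) : IwasawaAlgebra p)} • ⊤ :
        Submodule (IwasawaAlgebra p) M)) := by
  rw [← natDegree_cyclotomicLayer p n] at hlam ⊢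
  exact ⟨pow_dvd_natCard_quotient_smul_top (cyclotomic_comp_isDistinguishedAt_maximalIdeal p n) (constantCoeff_cyclotomicLayer p n)
    (prime_coe_cyclotomic_comp p n) hM hchar hlam, finite_quotient_smul_top' (cyclotomic_comp_isDistinguishedAt_maximalIdeal p n)
    (constantCoeff_cyclotomicLayer p n) (prime_coe_cyclotomic_comp p n) hM hchar hlam⟩

/-- ★★ **`#(X/Ψ_n X) = p^{pⁿ(p−1)·μ(f) + λ(f)} ⟺ X has no non-zero finite submodule`** (at any layer with `λ(f) < pⁿ(p−1)`): g54's exact layer index holds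
EXACTLY for the modules without finite submodule — one descent number detects Greenberg's Prop. 4.14–4.15 condition. [cite: Washington1997, §13.3 (Thm. 13.13)]
[cite: GreenbergLNM1716, Prop. 4.14–4.15] -/
theorem natCard_layerQuotient_eq_pow_iff [Module.Finite (IwasawaAlgebra p) M] (hM : Module.IsTorsion (IwasawaAlgebra p) M) {f : IwasawaAlgebra p}
    (hchar : Literature.NumberTheory.EllipticCurves.Module.charIdeal (IwasawaAlgebra p) M = Ideal.span {f}) {n : ℕ} (hlam : lam f < p ^ n * (p - 1)) :
    Nat.card (M ⧸ (Ideal.span {(((Polynomial.cyclotomic (p ^ (n + 1)) ℤ_[p]).comp (Polynomial.X + 1) : ℤ_[p][X]) : IwasawaAlgebra p)} • ⊤ :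
      Submodule (IwasawaAlgebra p) M)) = p ^ (p ^ n * (p - 1) * mu f + lam f) ↔ ∀ N : Submodule (IwasawaAlgebra p) M, Finite N → N = ⊥ := by
  rw [← natDegree_cyclotomicLayer p n] at hlam ⊢
  exact natCard_quotient_smul_top_eq_pow_iff (cyclotomic_comp_isDistinguishedAt_maximalIdeal p n) (constantCoeff_cyclotomicLayer p n)
    (prime_coe_cyclotomic_comp p n) hM hchar hlam

/-- ★★★ **GREENBERG'S `μ = 0` FROM ONE UPPER BOUND.** `X` ANY finitely generated torsion `Λ`-module (finite submodules allowed), `char_Λ X = (f)`; if at ONE layer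
`n` with `λ(f) < pⁿ(p−1)` the layer quotient satisfies **`#(X/Ψ_n X) < p^{pⁿ(p−1)}`**, then **`μ(f) = 0`**. No exact count, no «no finite submodule» hypothesis.
Reading for C2 (`p = 2`): `#(X/Ψ_n X) < 2^{2ⁿ}` at one layer with `2ⁿ > λ` certifies `μ₂ = 0` for the seed. [cite: Washington1997, §13.3 (Thm. 13.13)]
[cite: GreenbergLNM1716, Conj. 1.11 and p. 180] -/
theorem mu_eq_zero_of_natCard_layerQuotient_lt [Module.Finite (IwasawaAlgebra p) M] (hM : Module.IsTorsion (IwasawaAlgebra p) M) {f : IwasawaAlgebra p}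
    (hchar : Literature.NumberTheory.EllipticCurves.Module.charIdeal (IwasawaAlgebra p) M = Ideal.span {f}) {n : ℕ} (hlam : lam f < p ^ n * (p - 1))
    (hlt : Nat.card (M ⧸ (Ideal.span {(((Polynomial.cyclotomic (p ^ (n + 1)) ℤ_[p]).comp (Polynomial.X + 1) : ℤ_[p][X]) : IwasawaAlgebra p)} • ⊤ :
      Submodule (IwasawaAlgebra p) M)) < p ^ (p ^ n * (p - 1))) : mu f = 0 := by
  rw [← natDegree_cyclotomicLayer p n] at hlam hlt
  exact mu_eq_zero_of_natCard_quotient_smul_top_lt (cyclotomic_comp_isDistinguishedAt_maximalIdeal p n) (constantCoeff_cyclotomicLayer p n)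
    (prime_coe_cyclotomic_comp p n) hM hchar hlam hlt

/-- The same read with the `μ`-invariant OF THE MODULE (`μ(X) = μ(f)` for any generator `f` of `char_Λ X`, tree `mu_generator_eq_muInvariant`): for `X` f.g.
torsion with `char_Λ X = (f)`, `λ(f) < pⁿ(p−1)` and `#(X/Ψ_n X) < p^{pⁿ(p−1)}`: **`μ(X) = 0`**. [cite: Washington1997, §13.2–13.3] [cite: GreenbergLNM1716, Conj. 1.11] -/
theorem muInvariant_eq_zero_of_natCard_layerQuotient_lt [Module.Finite (IwasawaAlgebra p) M] (hM : Module.IsTorsion (IwasawaAlgebra p) M)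
    {f : IwasawaAlgebra p} (hchar : Literature.NumberTheory.EllipticCurves.Module.charIdeal (IwasawaAlgebra p) M = Ideal.span {f}) {n : ℕ}
    (hlam : lam f < p ^ n * (p - 1))
    (hlt : Nat.card (M ⧸ (Ideal.span {(((Polynomial.cyclotomic (p ^ (n + 1)) ℤ_[p]).comp (Polynomial.X + 1) : ℤ_[p][X]) : IwasawaAlgebra p)} • ⊤ :
      Submodule (IwasawaAlgebra p) M)) < p ^ (p ^ n * (p - 1))) : muInvariant p M = 0 := by
  have hμ := mu_eq_zero_of_natCard_layerQuotient_lt hM hchar hlam hlt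
  -- `f ≠ 0` (a generator of the characteristic ideal of a f.g. torsion module)
  obtain ⟨f', hf'0, hcharf'⟩ := exists_charGenerator_ne_zero M hM
  have hf0 : f ≠ 0 := by
    intro h
    rw [hchar, h, Ideal.span_singleton_eq_span_singleton] at hcharf'
    exact hf'0 (associated_zero_iff_eq_zero _ |>.mp hcharf'.symm)
  rw [← Summit.BirchSwinnertonDyer.Rank1Residual.X1.MuPart.mu_generator_eq_muInvariant M hM hf0 hchar, hμ]

end Layer

end Summit.BirchSwinnertonDyer.BirchSwinnertonDyer.Theorems.AlignedTransportAtTwoHalfDescentLayerIndexFinite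

end
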